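import Literature.Barriers.Parity.SiegelZeroDichotomyPairHLProp72Tools
import HarnessLib

/-!
# Tao–Teräväinen 2022, Proposition 7.2 (`k = 2`): eliminating `Λ♭_Siegel`

Topic `Literature/Barriers/Parity`, sub-namespace `TaoTeravainen`; a file of the proof DAG of
`Literature.Barriers.Parity.TaoTeravainen2021_prop72_81_pair` (T. Tao, J. Teräväinen, *The
Hardy–Littlewood–Chowla conjecture in the presence of a Siegel zero*, J. London Math. Soc. (2) 106
(2022), arXiv:2109.06291), **Proposition 7.2** (Eliminating the contribution of `Λ♭_Siegel`):
"`∑_{n ≤ x} Λ♭_Siegel(n+h₁) ∏_{j=2}^k Λ_j(n+h_j) ≪ x^{1-ε}` whenever `Λ_j ∈ {Λ_Siegel, Λ♯_Siegel}`",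
with the proof: expand `χ∗log` and `(χ∗log)♯` as integrals of `χ∗Φ_t`, "it suffices by the
triangle inequality and dyadic decomposition to show that
`∑_{n≤x} Λ♭(n+h₁) ∏ (χ∗Φ_{t_j})(n+h_j) ν(n+h_j) ≪ x^{1-2ε}` … Suppose first that `t₂ ≥ x^{1/2}` …
From (2.16) and summation by parts, it suffices to show … this follows from Proposition 7.1(ii)
… Now suppose that `t₂ < x^{1/2}` … `χ((n+h₂)/d₂)` … `f(n) = 1_{n = -h_j/d_j mod d₂*/d_j} χ(n)` …".

Here `k = 2`, all PROVED:

* `flatKernelSieveSum` — `S(u) = ∑_{n ≤ x} Λ♭(n+h) K_u(n+h') ν(n+h')` and its bound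
  `abs_flatKernelSieveSum_le` (the two cases `e^u ≥ x^{1/2}` — Abel summation — and
  `e^u < x^{1/2}` — the twist `χ((n+h')/b)` —, both reduced to Proposition 7.1 (ii));
* `prop72_pair` — **Proposition 7.2 for `k = 2`**: for `G ∈ {Λ_Siegel, Λ♭_Siegel}`,
  `|∑_{n ≤ x} Λ♭_Siegel(n+h) G(n+h')| ≤ C x^{1-c}` (`h ≠ h'`), hence also for `G = Λ♯_Siegel`.
  [cite: TaoTeravainen2021, Proposition 7.2]
-/

noncomputable section

open Finset Real MeasureTheory
open scoped ContDiff Topology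

namespace Literature.Barriers.Parity

namespace TaoTeravainen

open Literature.Analysis.Calculus

variable {q : ℕ}

/-! ### Regrouping the triple expansion -/

/-- The regrouping `∑_n a(n) K(m) ν(m) = ∑_{e,e',d} λ_e λ_{e'} ∑_n a(n) 1_{e,e',d ∣ m} κ(d,m)`
(`m = n + h'`), given expansions of `K` over `d ≤ Y` and of `ν` over `E × E`. [folklore] -/
theorem sum_mul_expand (a K ν : ℕ → ℝ) (κ : ℕ → ℕ → ℝ) (lam : ℕ → ℝ) (E : Finset ℕ) (x h' Y : ℕ)
    (hK : ∀ n ∈ Icc 1 x, K (n + h') = ∑ d ∈ Icc 1 Y, if d ∣ n + h' then κ d (n + h') else 0)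
    (hν : ∀ n ∈ Icc 1 x, ν (n + h') =
      ∑ e ∈ E, ∑ e' ∈ E, lam e * lam e' * (if e ∣ n + h' ∧ e' ∣ n + h' then 1 else 0)) :
    ∑ n ∈ Icc 1 x, a n * K (n + h') * ν (n + h') =
      ∑ e ∈ E, ∑ e' ∈ E, ∑ d ∈ Icc 1 Y, lam e * lam e' *
        ∑ n ∈ Icc 1 x, a n * (if e ∣ n + h' ∧ e' ∣ n + h' ∧ d ∣ n + h' then κ d (n + h') else 0) := by
  have hterm : ∀ n ∈ Icc 1 x, a n * K (n + h') * ν (n + h') =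
      ∑ e ∈ E, ∑ e' ∈ E, ∑ d ∈ Icc 1 Y, lam e * lam e' *
        (a n * (if e ∣ n + h' ∧ e' ∣ n + h' ∧ d ∣ n + h' then κ d (n + h') else 0)) := by
    intro n hn
    rw [hK n hn, hν n hn, mul_sum]
    refine sum_congr rfl fun e _ => ?_
    rw [mul_sum]
    refine sum_congr rfl fun e' _ => ?_
    rw [mul_sum, sum_mul]
    refine sum_congr rfl fun d _ => ?_
    by_cases h1 : e ∣ n + h' ∧ e' ∣ n + h' <;> by_cases h2 : d ∣ n + h'
    · rw [if_pos h1, if_pos h2, if_pos (show e ∣ n + h' ∧ e' ∣ n + h' ∧ d ∣ n + h' from ⟨h1.1, h1.2, h2⟩)]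
      ring
    · rw [if_neg h2, if_neg (show ¬(e ∣ n + h' ∧ e' ∣ n + h' ∧ d ∣ n + h') from fun h => h2 h.2.2)]
      ring
    · rw [if_neg h1, if_neg (show ¬(e ∣ n + h' ∧ e' ∣ n + h' ∧ d ∣ n + h') from fun h => h1 ⟨h.1, h.2.1⟩)]
      ring
    · rw [if_neg h1, if_neg (show ¬(e ∣ n + h' ∧ e' ∣ n + h' ∧ d ∣ n + h') from fun h => h1 ⟨h.1, h.2.1⟩)]
      ring
  rw [sum_congr rfl hterm, sum_comm]
  refine sum_congr rfl fun e _ => ?_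
  rw [sum_comm]
  refine sum_congr rfl fun e' _ => ?_
  rw [sum_comm]
  refine sum_congr rfl fun d _ => ?_
  rw [mul_sum]

/-! ### The two cases for one triple `(e, e', d)` -/

/-- The combined divisibility `e, e', d ∣ n + h'` as a congruence on `N = n + h`:
`N ≡ h - h' (mod [d, [e, e']])`. [folklore] -/
theorem dvd_conj_iff_modEq {e e' d n h h' : ℕ} :
    (e ∣ n + h' ∧ e' ∣ n + h' ∧ d ∣ n + h') ↔
      ((n + h : ℕ) : ℤ) ≡ (h : ℤ) - h' [ZMOD (Nat.lcm d (Nat.lcm e e') : ℕ)] := by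
  rw [show (e ∣ n + h' ∧ e' ∣ n + h' ∧ d ∣ n + h') ↔ Nat.lcm d (Nat.lcm e e') ∣ n + h' by
    rw [Nat.lcm_dvd_iff, Nat.lcm_dvd_iff]; tauto]
  rw [Int.modEq_iff_dvd, show (h : ℤ) - h' - ((n + h : ℕ) : ℤ) = -((n + h' : ℕ) : ℤ) by push_cast; ring,
    dvd_neg, Int.natCast_dvd_natCast]

/-- **Case `t ≥ x^{1/2}`** (Abel summation + Proposition 7.1 (ii) with `f ≡ 1`): for the weight
`κ(d, m) = χ(d) Φ_{t d}(m)`, `|∑_{n ≤ x} Λ♭(n+h) 1_{e,e',d ∣ n+h'} κ(d, n+h')| ≤ (sup|φ| + 17 sup|φ'|) C₂ (H+1)² x^{1-c₂}/[d,[e,e']]`.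
[cite: TaoTeravainen2021, proof of Proposition 7.2 (the case `t₂ ≥ x^{1/2}`)] -/
theorem abs_tripleSum_le_large (χ : DirichletCharacter ℂ q) [NeZero q] {φ ψ : ℝ → ℝ} (hφ : IsBump φ)
    {B₀ B₁ : ℝ} (hB₀ : ∀ u, |φ u| ≤ B₀) (hB₁ : ∀ u, |deriv φ u| ≤ B₁) {X U₀ R : ℝ} (hR : 1 < R)
    {x h h' H : ℕ} (hh : h ≤ H) (hh' : h' ≤ H) (hne : h ≠ h') (hHx : H ≤ x)
    (hHsq : ((H : ℝ) + 1) ^ 2 ≤ (x : ℝ) ^ (1 / 2 : ℝ)) {C₂ c₂ : ℝ} (hC₂ : 0 ≤ C₂)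
    (H71 : ∀ (L : ℕ), 0 < L → (L : ℝ) ≤ 12 * (x : ℝ) ^ (1 / 2 : ℝ) * R ^ 2 →
      ∀ (a : ℤ), (((Int.gcd a L : ℕ) : ℝ) + 1) ^ 2 ≤ (x : ℝ) ^ (1 / 2 : ℝ) →
      ∀ (f : ℤ → ℝ), (∀ k, |f k| ≤ 1) → (∀ k : ℤ, f (k + q) = f k) →
      ∀ (N₁ N₂ : ℕ), 1 ≤ N₁ → (N₂ : ℝ) ≤ 2 * x →
        |∑ N ∈ (Icc N₁ N₂).filter (fun N : ℕ => (N : ℤ) ≡ a [ZMOD L]),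
            vonMangoldtSiegelFlat χ φ ψ X U₀ R N * f (((N : ℤ) - a) / L)| ≤
          C₂ * (((Int.gcd a L : ℕ) : ℝ) + 1) ^ 2 * (x : ℝ) ^ (1 - c₂) / L)
    {u : ℝ} (hu : 2 ≤ Real.exp (u - 1)) {Y : ℕ} (hY : (Y : ℝ) ≤ 12 * (x : ℝ) ^ (1 / 2 : ℝ))
    {e e' : ℕ} (he : e ∈ sieveRange R) (he' : e' ∈ sieveRange R) {d : ℕ} (hd : d ∈ Icc 1 Y) :
    |∑ n ∈ Icc 1 x, vonMangoldtSiegelFlat χ φ ψ X U₀ R (n + h) *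
        (if e ∣ n + h' ∧ e' ∣ n + h' ∧ d ∣ n + h' then
          realChar χ d * logBump φ (u + Real.log d) ((n + h' : ℕ) : ℝ) else 0)| ≤
      (B₀ + 17 * B₁) * (C₂ * ((H : ℝ) + 1) ^ 2 * (x : ℝ) ^ (1 - c₂) / (Nat.lcm d (Nat.lcm e e') : ℕ)) := by
  rw [mem_sieveRange] at he he'
  rw [mem_Icc] at hd
  have hB₀0 : 0 ≤ B₀ := (abs_nonneg _).trans (hB₀ 0)
  have hB₁0 : 0 ≤ B₁ := (abs_nonneg _).trans (hB₁ 0)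
  have hR0 : 0 ≤ R := by linarith
  set M₀ : ℕ := Nat.lcm d (Nat.lcm e e') with hM₀
  have hM₀pos : 0 < M₀ := Nat.lcm_pos hd.1 (Nat.lcm_pos he.1 he'.1)
  have hM₀le : (M₀ : ℝ) ≤ 12 * (x : ℝ) ^ (1 / 2 : ℝ) * R ^ 2 := by
    have h1 : M₀ ≤ d * (e * e') := by
      refine Nat.le_of_dvd (Nat.mul_pos hd.1 (Nat.mul_pos he.1 he'.1)) ?_
      exact (Nat.lcm_dvd_mul d _).trans (Nat.mul_dvd_mul_left d (Nat.lcm_dvd_mul e e'))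
    calc (M₀ : ℝ) ≤ ((d * (e * e') : ℕ) : ℝ) := by exact_mod_cast h1
      _ = (d : ℝ) * (e * e') := by push_cast; ring
      _ ≤ Y * (R * R) := by
          refine mul_le_mul (by exact_mod_cast hd.2) (mul_le_mul he.2.le he'.2.le (Nat.cast_nonneg _) hR0)
            (by positivity) (Nat.cast_nonneg _)
      _ ≤ (12 * (x : ℝ) ^ (1 / 2 : ℝ)) * R ^ 2 := by rw [← sq]; gcongr
      _ = _ := by ring
  set a : ℤ := (h : ℤ) - h' with ha
  have ha0 : a ≠ 0 := by rw [ha]; omega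
  have hgcd : (((Int.gcd a M₀ : ℕ) : ℝ) + 1) ^ 2 ≤ (x : ℝ) ^ (1 / 2 : ℝ) := by
    have h1 : Int.gcd a M₀ ≤ H := by
      have h2 : (Int.gcd a M₀ : ℤ) ∣ a := Int.gcd_dvd_left _ _
      have h3 : Int.gcd a M₀ ≤ Int.natAbs a := Nat.le_of_dvd (Int.natAbs_pos.mpr ha0) (Int.natCast_dvd.mp h2)
      have h4 : Int.natAbs a ≤ H := by rw [ha]; omega
      exact h3.trans h4
    have : ((Int.gcd a M₀ : ℕ) : ℝ) ≤ H := by exact_mod_cast h1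
    calc (((Int.gcd a M₀ : ℕ) : ℝ) + 1) ^ 2 ≤ ((H : ℝ) + 1) ^ 2 := by gcongr
      _ ≤ _ := hHsq
  have hgcdH : Int.gcd a M₀ ≤ H := by
    have h2 : (Int.gcd a M₀ : ℤ) ∣ a := Int.gcd_dvd_left _ _
    have h3 : Int.gcd a M₀ ≤ Int.natAbs a := Nat.le_of_dvd (Int.natAbs_pos.mpr ha0) (Int.natCast_dvd.mp h2)
    have h4 : Int.natAbs a ≤ H := by rw [ha]; omega
    exact h3.trans h4
  set M : ℝ := C₂ * ((H : ℝ) + 1) ^ 2 * (x : ℝ) ^ (1 - c₂) / M₀ with hMdef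
  have hM0 : 0 ≤ M := by positivity
  -- reindex `N = n + h`
  set c : ℕ → ℝ := fun N => if (N : ℤ) ≡ a [ZMOD M₀] then vonMangoldtSiegelFlat χ φ ψ X U₀ R N else 0 with hc
  set W : ℕ → ℝ := fun N => realChar χ d * logBump φ (u + Real.log d) ((N + h' - h : ℕ) : ℝ) with hW
  have hreindex : ∑ n ∈ Icc 1 x, vonMangoldtSiegelFlat χ φ ψ X U₀ R (n + h) *
      (if e ∣ n + h' ∧ e' ∣ n + h' ∧ d ∣ n + h' then
        realChar χ d * logBump φ (u + Real.log d) ((n + h' : ℕ) : ℝ) else 0) =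
      ∑ N ∈ Icc (1 + h) (x + h), c N * W N := by
    rw [← Finset.map_add_right_Icc, sum_map]
    refine sum_congr rfl fun n _ => ?_
    simp only [addRightEmbedding_apply, hc, hW]
    rw [show n + h + h' - h = n + h' by omega]
    by_cases hcond : e ∣ n + h' ∧ e' ∣ n + h' ∧ d ∣ n + h'
    · have hcond' : ((n + h : ℕ) : ℤ) ≡ a [ZMOD M₀] := by
        rw [ha, hM₀]; exact dvd_conj_iff_modEq.mp hcond
      rw [if_pos hcond, if_pos hcond']
    · have hcond' : ¬ (((n + h : ℕ) : ℤ) ≡ a [ZMOD M₀]) := fun hc' =>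
        hcond (by rw [ha, hM₀] at hc'; exact dvd_conj_iff_modEq.mpr hc')
      rw [if_neg hcond, if_neg hcond']; simp
  rw [hreindex]
  -- the partial sums
  have hA : ∀ N' ∈ Icc (1 + h) (x + h), |∑ k ∈ Icc (1 + h) N', c k| ≤ M := by
    intro N' hN'
    rw [mem_Icc] at hN'
    have h1 : ∑ k ∈ Icc (1 + h) N', c k =
        ∑ N ∈ (Icc (1 + h) N').filter (fun N : ℕ => (N : ℤ) ≡ a [ZMOD M₀]),
          vonMangoldtSiegelFlat χ φ ψ X U₀ R N * (fun _ : ℤ => (1 : ℝ)) (((N : ℤ) - a) / M₀) := by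
      rw [sum_filter]
      refine sum_congr rfl fun N _ => ?_
      simp only [hc, mul_one]
    rw [h1]
    have h2 := H71 M₀ hM₀pos hM₀le a hgcd (fun _ => 1) (fun _ => by simp) (fun _ => rfl) (1 + h) N'
      (by omega) (by
        have : (N' : ℝ) ≤ x + H := by exact_mod_cast (hN'.2.trans (by omega))
        have hHx' : (H : ℝ) ≤ x := by exact_mod_cast hHx
        linarith)
    refine h2.trans ?_
    rw [hMdef]
    have : ((Int.gcd a M₀ : ℕ) : ℝ) ≤ H := by exact_mod_cast hgcdH
    gcongr
  have habel := abs_sum_Icc_mul_le_abel c W hM0 hA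
  refine habel.trans ?_
  rw [mul_comm]
  refine mul_le_mul_of_nonneg_right ?_ hM0
  -- `|W(hi)| ≤ B₀` and the variation `≤ 17 B₁`
  have hχd : |realChar χ d| ≤ 1 := abs_realChar_le_one χ d
  have hWle : ∀ N, |W N| ≤ B₀ := by
    intro N
    simp only [hW]
    rw [abs_mul]
    have : |logBump φ (u + Real.log d) ((N + h' - h : ℕ) : ℝ)| ≤ B₀ := by
      unfold logBump; split_ifs
      · exact hB₀ _
      · rw [abs_zero]; exact hB₀0
    calc |realChar χ d| * |logBump φ (u + Real.log d) ((N + h' - h : ℕ) : ℝ)| ≤ 1 * B₀ :=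
          mul_le_mul hχd this (abs_nonneg _) zero_le_one
      _ = B₀ := one_mul _
  have hvar : ∑ N ∈ Ico (1 + h) (x + h), |W N - W (N + 1)| ≤ 17 * B₁ := by
    set v : ℝ := u + Real.log d with hv
    have hv2 : 2 ≤ Real.exp (v - 1) := by
      refine hu.trans (Real.exp_le_exp.mpr ?_)
      rw [hv]
      have : 0 ≤ Real.log d := Real.log_nonneg (by exact_mod_cast hd.1)
      linarith
    have hterm : ∀ N ∈ Ico (1 + h) (x + h), |W N - W (N + 1)| ≤
        |logBump φ v ((N + h' - h : ℕ) : ℝ) - logBump φ v (((N + h' - h : ℕ) : ℝ) + 1)| := by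
      intro N hN
      rw [mem_Ico] at hN
      simp only [hW]
      rw [← mul_sub, abs_mul, show ((N + 1 + h' - h : ℕ) : ℝ) = ((N + h' - h : ℕ) : ℝ) + 1 by
        rw [show N + 1 + h' - h = (N + h' - h) + 1 by omega]; push_cast; ring]
      calc |realChar χ d| * _ ≤ 1 * _ := mul_le_mul_of_nonneg_right hχd (abs_nonneg _)
        _ = _ := one_mul _
    refine (sum_le_sum hterm).trans ?_
    -- reindex `m = N + h' - h ∈ [1 + h', x + h')`, a subset of `[1, x + h']`
    have hinj : ∑ N ∈ Ico (1 + h) (x + h),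
        |logBump φ v ((N + h' - h : ℕ) : ℝ) - logBump φ v (((N + h' - h : ℕ) : ℝ) + 1)| ≤
        ∑ m ∈ Icc 1 (x + h'), |logBump φ v m - logBump φ v (m + 1)| := by
      rw [← Finset.sum_image (f := fun m : ℕ => |logBump φ v m - logBump φ v (m + 1)|)
        (s := Ico (1 + h) (x + h)) (g := fun N => N + h' - h) (fun N hN N' hN' hNN' => by
          rw [coe_Ico, Set.mem_Ico] at hN hN'; simp only at hNN'; omega)]
      refine sum_le_sum_of_subset_of_nonneg (fun m hm => ?_) (fun _ _ _ => abs_nonneg _)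
      rw [mem_image] at hm
      obtain ⟨N, hN, rfl⟩ := hm
      rw [mem_Ico] at hN
      rw [mem_Icc]; omega
    exact hinj.trans (sum_abs_logBump_sub_le hφ hB₁ hv2 (x + h'))
  linarith [hWle (x + h)]

/-- **Case `t < x^{1/2}`** (the twist `χ((n+h')/b)` + Proposition 7.1 (ii) with `f = χ`, `χ` real):
for the weight `κ(b, m) = χ(m/b) φ(log b - u)`,
`|∑_{n ≤ x} Λ♭(n+h) 1_{e,e',b ∣ n+h'} κ(b, n+h')| ≤ sup|φ| C₂ (H+1)² x^{1-c₂}/[b,[e,e']]`.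
[cite: TaoTeravainen2021, proof of Proposition 7.2 (the case `t₂ < x^{1/2}`)] -/
theorem abs_tripleSum_le_small (χ : DirichletCharacter ℂ q) [NeZero q] (hχ : χ.IsQuadratic)
    {φ ψ : ℝ → ℝ} {B₀ : ℝ} (hB₀ : ∀ u, |φ u| ≤ B₀) {X U₀ R : ℝ} (hR : 1 < R)
    {x h h' H : ℕ} (hh : h ≤ H) (hh' : h' ≤ H) (hne : h ≠ h') (hHx : H ≤ x)
    (hHsq : ((H : ℝ) + 1) ^ 2 ≤ (x : ℝ) ^ (1 / 2 : ℝ)) {C₂ c₂ : ℝ} (hC₂ : 0 ≤ C₂)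
    (H71 : ∀ (L : ℕ), 0 < L → (L : ℝ) ≤ 12 * (x : ℝ) ^ (1 / 2 : ℝ) * R ^ 2 →
      ∀ (a : ℤ), (((Int.gcd a L : ℕ) : ℝ) + 1) ^ 2 ≤ (x : ℝ) ^ (1 / 2 : ℝ) →
      ∀ (f : ℤ → ℝ), (∀ k, |f k| ≤ 1) → (∀ k : ℤ, f (k + q) = f k) →
      ∀ (N₁ N₂ : ℕ), 1 ≤ N₁ → (N₂ : ℝ) ≤ 2 * x →
        |∑ N ∈ (Icc N₁ N₂).filter (fun N : ℕ => (N : ℤ) ≡ a [ZMOD L]),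
            vonMangoldtSiegelFlat χ φ ψ X U₀ R N * f (((N : ℤ) - a) / L)| ≤
          C₂ * (((Int.gcd a L : ℕ) : ℝ) + 1) ^ 2 * (x : ℝ) ^ (1 - c₂) / L)
    (u : ℝ) {Y : ℕ} (hY : (Y : ℝ) ≤ 12 * (x : ℝ) ^ (1 / 2 : ℝ))
    {e e' : ℕ} (he : e ∈ sieveRange R) (he' : e' ∈ sieveRange R) {b : ℕ} (hb : b ∈ Icc 1 Y) :
    |∑ n ∈ Icc 1 x, vonMangoldtSiegelFlat χ φ ψ X U₀ R (n + h) *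
        (if e ∣ n + h' ∧ e' ∣ n + h' ∧ b ∣ n + h' then
          realChar χ ((n + h') / b) * φ (Real.log b - u) else 0)| ≤
      B₀ * (C₂ * ((H : ℝ) + 1) ^ 2 * (x : ℝ) ^ (1 - c₂) / (Nat.lcm b (Nat.lcm e e') : ℕ)) := by
  rw [mem_sieveRange] at he he'
  rw [mem_Icc] at hb
  have hB₀0 : 0 ≤ B₀ := (abs_nonneg _).trans (hB₀ 0)
  have hR0 : 0 ≤ R := by linarith
  set M₀ : ℕ := Nat.lcm b (Nat.lcm e e') with hM₀
  have hM₀pos : 0 < M₀ := Nat.lcm_pos hb.1 (Nat.lcm_pos he.1 he'.1)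
  have hbM₀ : b ∣ M₀ := Nat.dvd_lcm_left _ _
  have hM₀le : (M₀ : ℝ) ≤ 12 * (x : ℝ) ^ (1 / 2 : ℝ) * R ^ 2 := by
    have h1 : M₀ ≤ b * (e * e') := by
      refine Nat.le_of_dvd (Nat.mul_pos hb.1 (Nat.mul_pos he.1 he'.1)) ?_
      exact (Nat.lcm_dvd_mul b _).trans (Nat.mul_dvd_mul_left b (Nat.lcm_dvd_mul e e'))
    calc (M₀ : ℝ) ≤ ((b * (e * e') : ℕ) : ℝ) := by exact_mod_cast h1
      _ = (b : ℝ) * (e * e') := by push_cast; ring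
      _ ≤ Y * (R * R) := by
          refine mul_le_mul (by exact_mod_cast hb.2) (mul_le_mul he.2.le he'.2.le (Nat.cast_nonneg _) hR0)
            (by positivity) (Nat.cast_nonneg _)
      _ ≤ (12 * (x : ℝ) ^ (1 / 2 : ℝ)) * R ^ 2 := by rw [← sq]; gcongr
      _ = _ := by ring
  set a : ℤ := (h : ℤ) - h' with ha
  have ha0 : a ≠ 0 := by rw [ha]; omega
  have hgcdH : Int.gcd a M₀ ≤ H := by
    have h2 : (Int.gcd a M₀ : ℤ) ∣ a := Int.gcd_dvd_left _ _
    have h3 : Int.gcd a M₀ ≤ Int.natAbs a := Nat.le_of_dvd (Int.natAbs_pos.mpr ha0) (Int.natCast_dvd.mp h2)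
    have h4 : Int.natAbs a ≤ H := by rw [ha]; omega
    exact h3.trans h4
  have hgcd : (((Int.gcd a M₀ : ℕ) : ℝ) + 1) ^ 2 ≤ (x : ℝ) ^ (1 / 2 : ℝ) := by
    have : ((Int.gcd a M₀ : ℕ) : ℝ) ≤ H := by exact_mod_cast hgcdH
    calc (((Int.gcd a M₀ : ℕ) : ℝ) + 1) ^ 2 ≤ ((H : ℝ) + 1) ^ 2 := by gcongr
      _ ≤ _ := hHsq
  -- the sum as `φ(log b - u) χ(M₀/b) ∑_{N ≡ a} Λ♭(N) χ((N-a)/M₀)`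
  have hreindex : ∑ n ∈ Icc 1 x, vonMangoldtSiegelFlat χ φ ψ X U₀ R (n + h) *
      (if e ∣ n + h' ∧ e' ∣ n + h' ∧ b ∣ n + h' then
        realChar χ ((n + h') / b) * φ (Real.log b - u) else 0) =
      (φ (Real.log b - u) * realChar χ (M₀ / b)) *
        ∑ N ∈ (Icc (1 + h) (x + h)).filter (fun N : ℕ => (N : ℤ) ≡ a [ZMOD M₀]),
          vonMangoldtSiegelFlat χ φ ψ X U₀ R N * intChar χ (((N : ℤ) - a) / M₀) := by
    rw [← Finset.map_add_right_Icc, sum_filter, sum_map, mul_sum]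
    refine sum_congr rfl fun n _ => ?_
    simp only [addRightEmbedding_apply]
    by_cases hcong : e ∣ n + h' ∧ e' ∣ n + h' ∧ b ∣ n + h'
    · -- `n + h' = M₀ k`, `χ((n+h')/b) = χ(M₀/b) χ(k)`, `k = (N - a)/M₀`
      have hcong' : ((n + h : ℕ) : ℤ) ≡ a [ZMOD M₀] := by
        rw [ha, hM₀]; exact dvd_conj_iff_modEq.mp hcong
      rw [if_pos hcong, if_pos hcong']
      obtain ⟨k, hk⟩ : M₀ ∣ n + h' := by
        rw [hM₀, Nat.lcm_dvd_iff, Nat.lcm_dvd_iff]; exact ⟨hcong.2.2, hcong.1, hcong.2.1⟩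
      have hkz : (((n + h : ℕ) : ℤ) - a) / M₀ = k := by
        rw [ha]; push_cast
        rw [show (n : ℤ) + h - ((h : ℤ) - h') = ((n + h' : ℕ) : ℤ) by push_cast; ring, hk]
        push_cast
        rw [Int.mul_ediv_cancel_left _ (by exact_mod_cast hM₀pos.ne')]
      have hq' : (n + h') / b = k * (M₀ / b) := by rw [hk, mul_comm, Nat.mul_div_assoc k hbM₀]
      rw [hkz, intChar_natCast, hq', realChar_mul χ hχ]
      ring
    · have hcong' : ¬ (((n + h : ℕ) : ℤ) ≡ a [ZMOD M₀]) := fun hc' =>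
        hcong (by rw [ha, hM₀] at hc'; exact dvd_conj_iff_modEq.mpr hc')
      rw [if_neg hcong, if_neg hcong']; simp
  rw [hreindex, abs_mul]
  have h1 : |φ (Real.log b - u) * realChar χ (M₀ / b)| ≤ B₀ := by
    rw [abs_mul]
    calc |φ (Real.log b - u)| * |realChar χ (M₀ / b)| ≤ B₀ * 1 :=
          mul_le_mul (hB₀ _) (abs_realChar_le_one χ _) (abs_nonneg _) hB₀0
      _ = B₀ := mul_one _
  have h2 := H71 M₀ hM₀pos hM₀le a hgcd (intChar χ) (abs_intChar_le_one χ) (intChar_add_natCast χ)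
    (1 + h) (x + h) (by omega) (by
      have : ((x + h : ℕ) : ℝ) ≤ x + H := by exact_mod_cast (show x + h ≤ x + H by omega)
      have hHx' : (H : ℝ) ≤ x := by exact_mod_cast hHx
      linarith)
  refine mul_le_mul h1 (h2.trans ?_) (abs_nonneg _) hB₀0
  have : ((Int.gcd a M₀ : ℕ) : ℝ) ≤ H := by exact_mod_cast hgcdH
  gcongr


/-! ### The expansions of `K_u` in the two ranges -/

/-- Restricting a divisor sum to `d ≤ Y` when the summand vanishes beyond. [folklore] -/
theorem sum_divisors_eq_sum_Icc_filter {m Y : ℕ} (hm : m ≠ 0) {g : ℕ → ℝ}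
    (hg : ∀ d ∈ m.divisors, Y < d → g d = 0) :
    ∑ d ∈ m.divisors, g d = ∑ d ∈ Icc 1 Y, if d ∣ m then g d else 0 := by
  rw [← sum_filter]
  have hsplit : ∑ d ∈ m.divisors, g d = ∑ d ∈ m.divisors.filter (fun d => d ≤ Y), g d := by
    rw [sum_filter_of_ne]
    intro d hd hne
    by_contra h
    exact hne (hg d hd (not_le.mp h))
  rw [hsplit]
  apply sum_congr
  · ext d
    simp only [mem_filter, Nat.mem_divisors, mem_Icc]
    constructor
    · rintro ⟨⟨h1, -⟩, h3⟩; exact ⟨⟨Nat.pos_of_dvd_of_pos h1 (Nat.pos_of_ne_zero hm), h3⟩, h1⟩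
    · rintro ⟨⟨-, h2⟩, h3⟩; exact ⟨⟨h3, hm⟩, h2⟩
  · intro d _; rfl

/-- **`K_u` for `e^u ≥ x^{1/2}`**: `K_u(m) = ∑_{d ≤ Y, d ∣ m} χ(d) Φ_{td}(m)` for `1 ≤ m ≤ 2x`,
`Y ≥ 12 x^{1/2} - 1`, `e^{u-1} ≥ x^{1/2}/e`. [cite: TaoTeravainen2021, proof of Proposition 7.2
(the case `t₂ ≥ x^{1/2}`: "`d₂ ≤ x^{1/2}`")] -/
theorem hypK_eq_sum_large (χ : DirichletCharacter ℂ q) {φ : ℝ → ℝ} (hφ : IsBump φ) {u : ℝ} {x m Y : ℕ}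
    (hm : 1 ≤ m) (hm2 : (m : ℝ) ≤ 2 * x) (hY : 12 * Real.sqrt x - 1 ≤ (Y : ℝ))
    (hu : Real.sqrt x / Real.exp 1 ≤ Real.exp (u - 1)) (hx : (1 : ℝ) ≤ x) :
    hypK χ φ u m = ∑ d ∈ Icc 1 Y, if d ∣ m then realChar χ d * logBump φ (u + Real.log d) m else 0 := by
  unfold hypK
  rw [Nat.sum_divisorsAntidiagonal (f := fun a b => realChar χ a * φ (Real.log b - u))]
  have hm0 : m ≠ 0 := by omega
  have hmr : (0 : ℝ) < m := by exact_mod_cast hm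
  -- identify the summand with `χ(d) Φ_{td}(m)`
  have hsame : ∀ d ∈ m.divisors, realChar χ d * φ (Real.log (m / d : ℕ) - u) =
      realChar χ d * logBump φ (u + Real.log d) m := by
    intro d hd
    have hd0 : d ≠ 0 := Nat.pos_of_mem_divisors hd |>.ne'
    congr 1
    unfold logBump
    rw [if_pos hmr, Nat.cast_div (Nat.dvd_of_mem_divisors hd) (by exact_mod_cast hd0),
      Real.log_div hmr.ne' (by exact_mod_cast hd0)]
    ring_nf
  rw [sum_congr rfl hsame]
  refine sum_divisors_eq_sum_Icc_filter hm0 fun d hd hYd => ?_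
  -- `d > Y ≥ 12√x - 1`: then `m/d < e^{u-1}` and `Φ = 0`
  have hd0 : (0 : ℝ) < d := by exact_mod_cast Nat.pos_of_mem_divisors hd
  rw [logBump_eq_zero hφ (Or.inl ?_), mul_zero]
  -- `m ≤ e^{u + log d - 1} = d e^{u-1}`
  rw [show u + Real.log d - 1 = Real.log d + (u - 1) by ring, Real.exp_add, Real.exp_log hd0]
  have hdY : (12 : ℝ) * Real.sqrt x ≤ d := by
    have : (Y : ℝ) + 1 ≤ d := by exact_mod_cast hYd
    linarith
  have hsx : Real.sqrt x * Real.sqrt x = x := Real.mul_self_sqrt (by linarith)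
  have hsx1 : 1 ≤ Real.sqrt x := by rw [← Real.sqrt_one]; exact Real.sqrt_le_sqrt hx
  have he : Real.exp 1 ≤ 3 := by have := Real.exp_one_lt_d9; linarith
  have hx0 : (0 : ℝ) ≤ x := by linarith
  calc (m : ℝ) ≤ 2 * x := hm2
    _ ≤ 12 * x / Real.exp 1 := by
        rw [le_div_iff₀ (Real.exp_pos 1)]; nlinarith [he, hx0, Real.exp_pos 1]
    _ = (12 * Real.sqrt x) * (Real.sqrt x / Real.exp 1) := by
        rw [mul_div_assoc', mul_assoc, hsx]
    _ ≤ (d : ℝ) * Real.exp (u - 1) := mul_le_mul hdY hu (by positivity) hd0.le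

/-- **`K_u` for `e^u < x^{1/2}`**: `K_u(m) = ∑_{b ≤ Y, b ∣ m} χ(m/b) φ(log b - u)` for `m ≥ 1`,
`e^{u+1} ≤ Y + 1`. [cite: TaoTeravainen2021, proof of Proposition 7.2 (the case `t₂ < x^{1/2}`)] -/
theorem hypK_eq_sum_small (χ : DirichletCharacter ℂ q) {φ : ℝ → ℝ} (hφ : IsBump φ) {u : ℝ} {m Y : ℕ}
    (hm : 1 ≤ m) (hY : Real.exp (u + 1) ≤ (Y : ℝ) + 1) :
    hypK χ φ u m = ∑ b ∈ Icc 1 Y, if b ∣ m then realChar χ (m / b) * φ (Real.log b - u) else 0 := by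
  unfold hypK
  rw [Nat.sum_divisorsAntidiagonal' (f := fun a b => realChar χ a * φ (Real.log b - u))]
  refine sum_divisors_eq_sum_Icc_filter (by omega) fun b hb hYb => ?_
  have hb1 : (Y : ℝ) + 1 ≤ b := by exact_mod_cast hYb
  have hb0 : (0 : ℝ) < b := by exact_mod_cast Nat.pos_of_mem_divisors hb
  rw [hφ.eq_zero _ ?_, mul_zero]
  have : u + 1 ≤ Real.log b := by
    rw [Real.le_log_iff_exp_le hb0]; linarith
  rw [abs_of_nonneg (by linarith)]; linarith

/-! ### The bound for one `u` -/

/-- `S(u) := ∑_{n ≤ x} Λ♭(n+h) K_u(n+h') ν(n+h')`. [cite: TaoTeravainen2021, proof of Proposition 7.2] -/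
def flatKernelSieveSum (χ : DirichletCharacter ℂ q) (φ ψ : ℝ → ℝ) (X U₀ R : ℝ) (x h h' : ℕ) (u : ℝ) : ℝ :=
  ∑ n ∈ Icc 1 x, vonMangoldtSiegelFlat χ φ ψ X U₀ R (n + h) * hypK χ φ u (n + h') *
    selbergSieve ψ R (n + h')

/-- **The bound for one `u`**: with the constant `C₂`, exponent `c₂` of Proposition 7.1 (ii) at
`x` (hypothesis `H71`), for `x ≥ 30`, `H ≤ x`, `(H+1)² ≤ x^{1/2}`, `h ≠ h' ≤ H`, `χ` real:
`|S(u)| ≤ (sup|ψ|)² (sup|φ| + 17 sup|φ'|) C₂ (H+1)² x^{1-c₂} R² (1 + log(12 x^{1/2}))` for every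
real `u` (both cases `e^u ≥ x^{1/2}`, `e^u < x^{1/2}`). [cite: TaoTeravainen2021, proof of
Proposition 7.2] -/
theorem abs_flatKernelSieveSum_le (χ : DirichletCharacter ℂ q) [NeZero q] (hχ : χ.IsQuadratic)
    {φ ψ : ℝ → ℝ} (hφ : IsBump φ) (hψ : IsSmoothCutoff ψ) {B₀ B₁ Bψ : ℝ} (hB₀ : ∀ u, |φ u| ≤ B₀)
    (hB₁ : ∀ u, |deriv φ u| ≤ B₁) (hBψ : ∀ u, |ψ u| ≤ Bψ) {X U₀ R : ℝ} (hR : 1 < R)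
    {x h h' H : ℕ} (hh : h ≤ H) (hh' : h' ≤ H) (hne : h ≠ h') (hHx : H ≤ x) (hx : (30 : ℝ) ≤ x)
    (hHsq : ((H : ℝ) + 1) ^ 2 ≤ (x : ℝ) ^ (1 / 2 : ℝ)) {C₂ c₂ : ℝ} (hC₂ : 0 ≤ C₂)
    (H71 : ∀ (L : ℕ), 0 < L → (L : ℝ) ≤ 12 * (x : ℝ) ^ (1 / 2 : ℝ) * R ^ 2 →
      ∀ (a : ℤ), (((Int.gcd a L : ℕ) : ℝ) + 1) ^ 2 ≤ (x : ℝ) ^ (1 / 2 : ℝ) →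
      ∀ (f : ℤ → ℝ), (∀ k, |f k| ≤ 1) → (∀ k : ℤ, f (k + q) = f k) →
      ∀ (N₁ N₂ : ℕ), 1 ≤ N₁ → (N₂ : ℝ) ≤ 2 * x →
        |∑ N ∈ (Icc N₁ N₂).filter (fun N : ℕ => (N : ℤ) ≡ a [ZMOD L]),
            vonMangoldtSiegelFlat χ φ ψ X U₀ R N * f (((N : ℤ) - a) / L)| ≤
          C₂ * (((Int.gcd a L : ℕ) : ℝ) + 1) ^ 2 * (x : ℝ) ^ (1 - c₂) / L)
    (u : ℝ) :
    |flatKernelSieveSum χ φ ψ X U₀ R x h h' u| ≤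
      Bψ ^ 2 * (B₀ + 17 * B₁) * (C₂ * ((H : ℝ) + 1) ^ 2 * (x : ℝ) ^ (1 - c₂)) * R ^ 2 *
        (1 + Real.log (12 * Real.sqrt x)) := by
  have hB₀0 : 0 ≤ B₀ := (abs_nonneg _).trans (hB₀ 0)
  have hB₁0 : 0 ≤ B₁ := (abs_nonneg _).trans (hB₁ 0)
  have hBψ0 : 0 ≤ Bψ := (abs_nonneg _).trans (hBψ 0)
  have hR0 : 0 ≤ R := by linarith
  have hx1 : (1 : ℝ) ≤ x := by linarith
  have hsqrt : Real.sqrt x = (x : ℝ) ^ (1 / 2 : ℝ) := Real.sqrt_eq_rpow _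
  have hsx1 : 1 ≤ Real.sqrt x := by rw [← Real.sqrt_one]; exact Real.sqrt_le_sqrt hx1
  set Y : ℕ := ⌊12 * Real.sqrt x⌋₊ with hYdef
  have hY : (Y : ℝ) ≤ 12 * (x : ℝ) ^ (1 / 2 : ℝ) := by rw [← hsqrt]; exact Nat.floor_le (by positivity)
  have hY' : 12 * Real.sqrt x - 1 ≤ (Y : ℝ) := by
    have := Nat.lt_floor_add_one (12 * Real.sqrt x); rw [hYdef]; linarith
  have hlogY : Real.log Y ≤ Real.log (12 * Real.sqrt x) := by
    rcases Nat.eq_zero_or_pos Y with h0 | h0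
    · rw [h0, Nat.cast_zero, Real.log_zero]; exact Real.log_nonneg (by linarith)
    · exact Real.log_le_log (by exact_mod_cast h0) (by rw [hsqrt]; exact hY)
  -- the expansion of `ν`
  have hν : ∀ n ∈ Icc 1 x, selbergSieve ψ R (n + h') = ∑ e ∈ sieveRange R, ∑ e' ∈ sieveRange R,
      sieveWt ψ R e * sieveWt ψ R e' * (if e ∣ n + h' ∧ e' ∣ n + h' then 1 else 0) := by
    intro n hn; rw [mem_Icc] at hn
    exact selbergSieve_eq_double_sum hψ hR (by omega)
  -- the common final estimate, given a bound `K/[d,[e,e']]` for every triple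
  set Mx : ℝ := C₂ * ((H : ℝ) + 1) ^ 2 * (x : ℝ) ^ (1 - c₂) with hMx
  have hMx0 : 0 ≤ Mx := by positivity
  have hfinal : ∀ (T : ℕ → ℕ → ℕ → ℝ),
      (∀ e ∈ sieveRange R, ∀ e' ∈ sieveRange R, ∀ d ∈ Icc 1 Y,
        |T e e' d| ≤ (B₀ + 17 * B₁) * (Mx / (Nat.lcm d (Nat.lcm e e') : ℕ))) →
      |∑ e ∈ sieveRange R, ∑ e' ∈ sieveRange R, ∑ d ∈ Icc 1 Y, sieveWt ψ R e * sieveWt ψ R e' * T e e' d| ≤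
        Bψ ^ 2 * (B₀ + 17 * B₁) * Mx * R ^ 2 * (1 + Real.log (12 * Real.sqrt x)) := by
    intro T hT
    have hlog0 : 0 ≤ 1 + Real.log (12 * Real.sqrt x) := by
      have : 0 ≤ Real.log (12 * Real.sqrt x) := Real.log_nonneg (by linarith); linarith
    calc |∑ e ∈ sieveRange R, ∑ e' ∈ sieveRange R, ∑ d ∈ Icc 1 Y, sieveWt ψ R e * sieveWt ψ R e' * T e e' d|
        ≤ ∑ e ∈ sieveRange R, ∑ e' ∈ sieveRange R, ∑ d ∈ Icc 1 Y,
            Bψ * Bψ * ((B₀ + 17 * B₁) * (Mx / (Nat.lcm d (Nat.lcm e e') : ℕ))) := by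
          refine (abs_sum_le_sum_abs _ _).trans (sum_le_sum fun e he => ?_)
          refine (abs_sum_le_sum_abs _ _).trans (sum_le_sum fun e' he' => ?_)
          refine (abs_sum_le_sum_abs _ _).trans (sum_le_sum fun d hd => ?_)
          rw [abs_mul, abs_mul]
          exact mul_le_mul (mul_le_mul (abs_sieveWt_le hBψ R e) (abs_sieveWt_le hBψ R e') (abs_nonneg _) hBψ0)
            (hT e he e' he' d hd) (abs_nonneg _) (by positivity)
      _ = Bψ ^ 2 * (B₀ + 17 * B₁) * Mx * ∑ e ∈ sieveRange R, ∑ e' ∈ sieveRange R,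
            ∑ d ∈ Icc 1 Y, (1 : ℝ) / (Nat.lcm d (Nat.lcm e e') : ℕ) := by
          rw [mul_sum]; refine sum_congr rfl fun e _ => ?_
          rw [mul_sum]; refine sum_congr rfl fun e' _ => ?_
          rw [mul_sum]; refine sum_congr rfl fun d _ => ?_
          ring
      _ ≤ Bψ ^ 2 * (B₀ + 17 * B₁) * Mx * ∑ _e ∈ sieveRange R, ∑ _e' ∈ sieveRange R,
            (1 + Real.log (12 * Real.sqrt x)) := by
          refine mul_le_mul_of_nonneg_left (sum_le_sum fun e he => sum_le_sum fun e' he' => ?_) (by positivity)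
          rw [mem_sieveRange] at he he'
          refine (sum_inv_lcm_le (Nat.lcm_pos he.1 he'.1) Y).trans ?_
          linarith [hlogY]
      _ = Bψ ^ 2 * (B₀ + 17 * B₁) * Mx * (((sieveRange R).card : ℝ) ^ 2 * (1 + Real.log (12 * Real.sqrt x))) := by
          rw [sum_const, sum_const, nsmul_eq_mul, nsmul_eq_mul]; ring
      _ ≤ Bψ ^ 2 * (B₀ + 17 * B₁) * Mx * (R ^ 2 * (1 + Real.log (12 * Real.sqrt x))) := by
          have := card_sieveRange_le hR0
          gcongr
      _ = _ := by ring
  unfold flatKernelSieveSum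
  by_cases hu : Real.log x / 2 ≤ u
  · -- `e^u ≥ x^{1/2}`
    have hexp : Real.sqrt x / Real.exp 1 ≤ Real.exp (u - 1) := by
      rw [Real.exp_sub, Real.sqrt_eq_rpow, Real.rpow_def_of_pos (by linarith), show Real.log x * (1 / 2) = Real.log x / 2 by ring]
      exact div_le_div_of_nonneg_right (Real.exp_le_exp.mpr hu) (Real.exp_pos 1).le
    have hu2 : 2 ≤ Real.exp (u - 1) := by
      refine le_trans ?_ hexp
      rw [le_div_iff₀ (Real.exp_pos 1)]
      have he : Real.exp 1 ≤ 2.72 := by have := Real.exp_one_lt_d9; linarith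
      have h30 : Real.sqrt 30 ≤ Real.sqrt x := Real.sqrt_le_sqrt hx
      have h5 : (5.44 : ℝ) ≤ Real.sqrt 30 := by
        rw [Real.le_sqrt (by norm_num) (by norm_num)]; norm_num
      linarith
    have hK : ∀ n ∈ Icc 1 x, hypK χ φ u (n + h') =
        ∑ d ∈ Icc 1 Y, if d ∣ n + h' then realChar χ d * logBump φ (u + Real.log d) ((n + h' : ℕ) : ℝ) else 0 := by
      intro n hn; rw [mem_Icc] at hn
      refine hypK_eq_sum_large χ hφ (by omega) ?_ hY' hexp hx1
      have : ((n + h' : ℕ) : ℝ) ≤ x + H := by exact_mod_cast (show n + h' ≤ x + H by omega)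
      have hHx' : (H : ℝ) ≤ x := by exact_mod_cast hHx
      linarith
    rw [sum_mul_expand (fun n => vonMangoldtSiegelFlat χ φ ψ X U₀ R (n + h)) (hypK χ φ u) (selbergSieve ψ R)
      (fun d m => realChar χ d * logBump φ (u + Real.log d) (m : ℝ)) (sieveWt ψ R) (sieveRange R) x h' Y hK hν]
    refine hfinal _ fun e he e' he' d hd => ?_
    rw [hMx]
    exact abs_tripleSum_le_large χ hφ hB₀ hB₁ hR hh hh' hne hHx hHsq hC₂ H71 hu2 hY he he' hd
  · -- `e^u < x^{1/2}`
    push Not at hu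
    have hexp : Real.exp (u + 1) ≤ (Y : ℝ) + 1 := by
      have h1 : Real.exp (u + 1) ≤ Real.exp 1 * Real.sqrt x := by
        rw [Real.exp_add, Real.sqrt_eq_rpow, Real.rpow_def_of_pos (by linarith), mul_comm]
        refine mul_le_mul_of_nonneg_left (Real.exp_le_exp.mpr (by linarith)) (Real.exp_pos 1).le
      have he : Real.exp 1 ≤ 3 := by have := Real.exp_one_lt_d9; linarith
      have : Real.exp 1 * Real.sqrt x ≤ 3 * Real.sqrt x := mul_le_mul_of_nonneg_right he (Real.sqrt_nonneg _)
      linarith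
    have hK : ∀ n ∈ Icc 1 x, hypK χ φ u (n + h') =
        ∑ b ∈ Icc 1 Y, if b ∣ n + h' then realChar χ ((n + h') / b) * φ (Real.log b - u) else 0 := by
      intro n hn; rw [mem_Icc] at hn
      exact hypK_eq_sum_small χ hφ (by omega) hexp
    rw [sum_mul_expand (fun n => vonMangoldtSiegelFlat χ φ ψ X U₀ R (n + h)) (hypK χ φ u) (selbergSieve ψ R)
      (fun b m => realChar χ (m / b) * φ (Real.log b - u)) (sieveWt ψ R) (sieveRange R) x h' Y hK hν]
    refine hfinal _ fun e he e' he' b hb => ?_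
    rw [hMx]
    refine (abs_tripleSum_le_small χ hχ hB₀ hR hh hh' hne hHx hHsq hC₂ H71 u hY he he' hb).trans ?_
    have hM0 : 0 ≤ C₂ * ((H : ℝ) + 1) ^ 2 * (x : ℝ) ^ (1 - c₂) / (Nat.lcm b (Nat.lcm e e') : ℕ) := by positivity
    nlinarith


/-! ### Integrating over `u` -/

/-- `u ↦ S(u)` is continuous. [folklore] -/
theorem continuous_flatKernelSieveSum (χ : DirichletCharacter ℂ q) {φ : ℝ → ℝ} (hφ : IsBump φ)
    (ψ : ℝ → ℝ) (X U₀ R : ℝ) (x h h' : ℕ) :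
    Continuous (flatKernelSieveSum χ φ ψ X U₀ R x h h') := by
  unfold flatKernelSieveSum
  refine continuous_finsetSum _ fun n _ => ?_
  exact (continuous_const.mul (continuous_hypK hφ χ _)).mul continuous_const

/-- `S(u) = 0` for `u < -1` and for `u > log(x + h') + 1`. [folklore] -/
theorem flatKernelSieveSum_eq_zero (χ : DirichletCharacter ℂ q) {φ : ℝ → ℝ} (hφ : IsBump φ)
    (ψ : ℝ → ℝ) (X U₀ R : ℝ) (x h h' : ℕ) {u : ℝ}
    (hu : u < -1 ∨ Real.log ((x + h' : ℕ) : ℝ) + 1 < u) :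
    flatKernelSieveSum χ φ ψ X U₀ R x h h' u = 0 := by
  unfold flatKernelSieveSum
  refine sum_eq_zero fun n hn => ?_
  rw [mem_Icc] at hn
  rw [hypK_eq_zero hφ χ ?_, mul_zero, zero_mul]
  rcases hu with hu | hu
  · exact Or.inl hu
  · right
    refine lt_of_le_of_lt ?_ hu
    have h1 : (0 : ℝ) < ((n + h' : ℕ) : ℝ) := by exact_mod_cast (show 0 < n + h' by omega)
    have h2 : ((n + h' : ℕ) : ℝ) ≤ ((x + h' : ℕ) : ℝ) := by exact_mod_cast (show n + h' ≤ x + h' by omega)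
    linarith [Real.log_le_log h1 h2]

/-- **`Λ_Siegel` slot**: `∑_{n≤x} Λ♭(n+h) Λ_Siegel(n+h') = ∫ S(u) u du`, hence
`|∑ Λ♭(n+h) Λ_Siegel(n+h')| ≤ (log(x+h') + 3)² · sup_u |S(u)|` ("`χ∗log` … can be expressed as
linear combinations of `χ∗Φ_t` for various `t`"). [cite: TaoTeravainen2021, proof of Proposition 7.2] -/
theorem abs_sum_flat_mul_siegel_le (χ : DirichletCharacter ℂ q) {φ : ℝ → ℝ} (hφ : IsBump φ)
    (ψ : ℝ → ℝ) (X U₀ R : ℝ) {x : ℕ} (hx : 1 ≤ x) (h h' : ℕ) {Sb : ℝ}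
    (hS : ∀ u, |flatKernelSieveSum χ φ ψ X U₀ R x h h' u| ≤ Sb) :
    |∑ n ∈ Icc 1 x, vonMangoldtSiegelFlat χ φ ψ X U₀ R (n + h) * vonMangoldtSiegel χ ψ R (n + h')| ≤
      (Real.log ((x + h' : ℕ) : ℝ) + 3) ^ 2 * Sb := by
  have hSb0 : 0 ≤ Sb := (abs_nonneg _).trans (hS 0)
  set L₁ : ℝ := Real.log ((x + h' : ℕ) : ℝ) + 1 with hL₁
  have hxh : (1 : ℝ) ≤ ((x + h' : ℕ) : ℝ) := by exact_mod_cast (show 1 ≤ x + h' by omega)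
  have hL₁1 : 1 ≤ L₁ := by have := Real.log_nonneg hxh; rw [hL₁]; linarith
  -- the identity
  have hid : ∑ n ∈ Icc 1 x, vonMangoldtSiegelFlat χ φ ψ X U₀ R (n + h) * vonMangoldtSiegel χ ψ R (n + h') =
      ∫ u, flatKernelSieveSum χ φ ψ X U₀ R x h h' u * u := by
    unfold flatKernelSieveSum vonMangoldtSiegel
    simp_rw [sum_mul]
    rw [integral_finsetSum]
    · refine sum_congr rfl fun n _ => ?_
      rw [charLog_eq_integral_hypK hφ χ (n + h'), ← MeasureTheory.integral_mul_const,
        ← MeasureTheory.integral_const_mul]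
      refine integral_congr_ae (Filter.Eventually.of_forall fun u => ?_)
      simp only; ring
    · intro n _
      have hc : Continuous fun u => vonMangoldtSiegelFlat χ φ ψ X U₀ R (n + h) * hypK χ φ u (n + h') *
          selbergSieve ψ R (n + h') * u :=
        ((continuous_const.mul (continuous_hypK hφ χ _)).mul continuous_const).mul continuous_id
      refine hc.integrable_of_hasCompactSupport ?_
      refine HasCompactSupport.of_support_subset_isCompact (isCompact_Icc (a := (-1 : ℝ))
        (b := Real.log ((n + h' : ℕ) : ℝ) + 1)) fun u hu => ?_
      rw [Function.mem_support] at hu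
      rw [Set.mem_Icc]
      by_contra hc'
      rw [not_and_or, not_le, not_le] at hc'
      exact hu (by rw [hypK_eq_zero hφ χ hc', mul_zero, zero_mul, zero_mul])
  rw [hid]
  -- the support and the bound
  have hzero : ∀ u ∉ Set.Icc (-1 : ℝ) L₁, flatKernelSieveSum χ φ ψ X U₀ R x h h' u * u = 0 := by
    intro u hu
    rw [Set.mem_Icc, not_and_or, not_le, not_le] at hu
    rw [flatKernelSieveSum_eq_zero χ hφ ψ X U₀ R x h h' (by rw [hL₁] at hu; exact hu), zero_mul]
  rw [← setIntegral_eq_integral_of_forall_compl_eq_zero hzero]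
  have hbound : ∀ u ∈ Set.Icc (-1 : ℝ) L₁, ‖flatKernelSieveSum χ φ ψ X U₀ R x h h' u * u‖ ≤ Sb * L₁ := by
    intro u hu
    rw [Set.mem_Icc] at hu
    rw [Real.norm_eq_abs, abs_mul]
    refine mul_le_mul (hS u) ?_ (abs_nonneg _) hSb0
    rw [abs_le]; constructor <;> linarith
  have h := norm_setIntegral_le_of_norm_le_const (μ := volume) (by rw [Real.volume_Icc]; exact ENNReal.ofReal_lt_top) hbound
  rw [Real.volume_real_Icc_of_le (by linarith), Real.norm_eq_abs] at h
  refine h.trans ?_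
  rw [hL₁]
  have : 0 ≤ Real.log ((x + h' : ℕ) : ℝ) := Real.log_nonneg hxh
  nlinarith

/-- **`Λ♭_Siegel` slot**: `∑_{n≤x} Λ♭(n+h) Λ♭(n+h') = ∫_{U₀}^{X-U₀} ρ(u) u S(u) du - P(U₀) S(U₀)`,
hence `|…| ≤ 2 (1 + sup|ψ|) X² · sup_u |S(u)|` (`0 < U₀`, `2U₀ ≤ X`). [cite: TaoTeravainen2021,
proof of Proposition 7.2] -/
theorem abs_sum_flat_mul_flat_le (χ : DirichletCharacter ℂ q) {φ ψ : ℝ → ℝ} (hφ : IsBump φ)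
    (hψ : IsSmoothCutoff ψ) {Bψ : ℝ} (hBψ : ∀ u, |ψ u| ≤ Bψ) {X U₀ : ℝ} (hU₀ : 0 < U₀) (hX : 2 * U₀ ≤ X)
    (R : ℝ) (x h h' : ℕ) {Sb : ℝ} (hS : ∀ u, |flatKernelSieveSum χ φ ψ X U₀ R x h h' u| ≤ Sb) :
    |∑ n ∈ Icc 1 x, vonMangoldtSiegelFlat χ φ ψ X U₀ R (n + h) *
        vonMangoldtSiegelFlat χ φ ψ X U₀ R (n + h')| ≤ 2 * ((1 + Bψ) * X ^ 2) * Sb := by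
  have hSb0 : 0 ≤ Sb := (abs_nonneg _).trans (hS 0)
  have hBψ0 : 0 ≤ 1 + Bψ := by linarith [(abs_nonneg _).trans (hBψ 0)]
  have hXU : U₀ ≤ X - U₀ := by linarith
  have hX0 : 0 ≤ X := by linarith
  set S := flatKernelSieveSum χ φ ψ X U₀ R x h h' with hSdef
  -- the identity
  have hid : ∑ n ∈ Icc 1 x, vonMangoldtSiegelFlat χ φ ψ X U₀ R (n + h) *
      vonMangoldtSiegelFlat χ φ ψ X U₀ R (n + h') =
      (∫ u in U₀..(X - U₀), flatWeight ψ X U₀ u * u * S u) - flatKernel ψ X U₀ U₀ * S U₀ := by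
    have hterm : ∀ n ∈ Icc 1 x, vonMangoldtSiegelFlat χ φ ψ X U₀ R (n + h) *
        vonMangoldtSiegelFlat χ φ ψ X U₀ R (n + h') =
        (∫ u in U₀..(X - U₀), flatWeight ψ X U₀ u * u *
          (vonMangoldtSiegelFlat χ φ ψ X U₀ R (n + h) * hypK χ φ u (n + h') * selbergSieve ψ R (n + h'))) -
          flatKernel ψ X U₀ U₀ * (vonMangoldtSiegelFlat χ φ ψ X U₀ R (n + h) * hypK χ φ U₀ (n + h') *
            selbergSieve ψ R (n + h')) := by
      intro n _
      conv_lhs => rw [show vonMangoldtSiegelFlat χ φ ψ X U₀ R (n + h') =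
        flatLog χ φ ψ X U₀ (n + h') * selbergSieve ψ R (n + h') from rfl]
      unfold flatLog flatKernel
      rw [sub_mul, mul_sub, ← intervalIntegral.integral_mul_const, ← intervalIntegral.integral_const_mul]
      congr 1
      · exact intervalIntegral.integral_congr fun u _ => by ring
      · ring
    have hint : ∀ n ∈ Icc 1 x, IntervalIntegrable (fun u => flatWeight ψ X U₀ u * u *
        (vonMangoldtSiegelFlat χ φ ψ X U₀ R (n + h) * hypK χ φ u (n + h') * selbergSieve ψ R (n + h')))
        volume U₀ (X - U₀) := by
      intro n _
      refine ContinuousOn.intervalIntegrable ?_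
      rw [Set.uIcc_of_le hXU]
      refine ((((continuousOn_flatWeight hψ X U₀).mono fun u hu => ?_).mul continuousOn_id).mul
        ((continuous_const.mul (continuous_hypK hφ χ _)).mul continuous_const).continuousOn)
      rw [Set.mem_Iic]; linarith [hu.2]
    rw [sum_congr rfl hterm, sum_sub_distrib, ← mul_sum, ← intervalIntegral.integral_finsetSum hint]
    congr 1
    · refine intervalIntegral.integral_congr fun u _ => ?_
      rw [hSdef]; unfold flatKernelSieveSum; rw [mul_sum]
  rw [hid]
  have h1 : |∫ u in U₀..(X - U₀), flatWeight ψ X U₀ u * u * S u| ≤ (1 + Bψ) * X * Sb * |X - U₀ - U₀| := by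
    have h := intervalIntegral.norm_integral_le_of_norm_le_const (a := U₀) (b := X - U₀)
      (C := (1 + Bψ) * X * Sb) (f := fun u => flatWeight ψ X U₀ u * u * S u) ?_
    · rwa [Real.norm_eq_abs] at h
    intro u hu
    rw [Set.uIoc_of_le hXU] at hu
    rw [Real.norm_eq_abs, abs_mul, abs_mul, abs_of_nonneg (by linarith [hu.1] : (0 : ℝ) ≤ u)]
    refine mul_le_mul (mul_le_mul (abs_flatWeight_le hBψ X U₀ u) (by linarith [hu.2]) (by linarith [hu.1]) hBψ0)
      (hS u) (abs_nonneg _) (by positivity)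
  have h2 : |flatKernel ψ X U₀ U₀ * S U₀| ≤ (1 + Bψ) * X * (X - U₀) * Sb := by
    rw [abs_mul]
    exact mul_le_mul (abs_flatKernel_le hBψ hU₀.le (by linarith)) (hS U₀) (abs_nonneg _) (by
      have : 0 ≤ X - U₀ := by linarith
      positivity)
  calc |(∫ u in U₀..(X - U₀), flatWeight ψ X U₀ u * u * S u) - flatKernel ψ X U₀ U₀ * S U₀|
      ≤ |∫ u in U₀..(X - U₀), flatWeight ψ X U₀ u * u * S u| + |flatKernel ψ X U₀ U₀ * S U₀| := abs_sub _ _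
    _ ≤ (1 + Bψ) * X * Sb * |X - U₀ - U₀| + (1 + Bψ) * X * (X - U₀) * Sb := add_le_add h1 h2
    _ ≤ (1 + Bψ) * X * Sb * X + (1 + Bψ) * X * X * Sb := by
        have hA : |X - U₀ - U₀| ≤ X := by rw [abs_of_nonneg (by linarith)]; linarith
        have hB : X - U₀ ≤ X := by linarith
        gcongr
    _ = 2 * ((1 + Bψ) * X ^ 2) * Sb := by ring


/-! ### Proposition 7.2 for `k = 2` -/

set_option maxHeartbeats 800000 in
/-- **Proposition 7.2** (`k = 2`): for `0 < ε₀ ≤ 1/100` and `H` there are `c > 0`, `C`, `x₀` such that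
for `x ≥ x₀`, a real character `χ (mod q_χ)` with `q_χ ≤ x^{1/20}`, `1 < R ≤ x^c`, and distinct
`h, h' ≤ H`: `|∑_{n≤x} Λ♭_Siegel(n+h) Λ_Siegel(n+h')| ≤ C x^{1-c}` and
`|∑_{n≤x} Λ♭_Siegel(n+h) Λ♭_Siegel(n+h')| ≤ C x^{1-c}` (so also for `Λ♯_Siegel = Λ_Siegel - Λ♭_Siegel`
in the second slot); here `Λ♭_Siegel` is taken with `X = log x`, `U₀ = log(x^{ε₀/20} q_χ²)`.
[cite: TaoTeravainen2021, Proposition 7.2] -/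
theorem prop72_pair {φ ψ : ℝ → ℝ} (hφ : IsBump φ) (hψ : IsSmoothCutoff ψ) {ε₀ : ℝ} (hε₀ : 0 < ε₀)
    (hε₀1 : ε₀ ≤ 1 / 100) (H : ℕ) :
    ∃ c : ℝ, 0 < c ∧ ∃ C : ℝ, 0 ≤ C ∧ ∃ x₀ : ℕ, ∀ x : ℕ, x₀ ≤ x →
      ∀ (q : ℕ) [NeZero q] (χ : DirichletCharacter ℂ q), χ.IsQuadratic → (q : ℝ) ≤ (x : ℝ) ^ (1 / 20 : ℝ) →
      ∀ (R : ℝ), 1 < R → R ≤ (x : ℝ) ^ c →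
      ∀ (h h' : ℕ), h ≤ H → h' ≤ H → h ≠ h' →
        |∑ n ∈ Icc 1 x, vonMangoldtSiegelFlat χ φ ψ (Real.log x) (ε₀ / 20 * Real.log x + 2 * Real.log q) R (n + h) *
            vonMangoldtSiegel χ ψ R (n + h')| ≤ C * (x : ℝ) ^ (1 - c) ∧
        |∑ n ∈ Icc 1 x, vonMangoldtSiegelFlat χ φ ψ (Real.log x) (ε₀ / 20 * Real.log x + 2 * Real.log q) R (n + h) *
            vonMangoldtSiegelFlat χ φ ψ (Real.log x) (ε₀ / 20 * Real.log x + 2 * Real.log q) R (n + h')| ≤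
          C * (x : ℝ) ^ (1 - c) := by
  obtain ⟨c₂, hc₂, C₂, hC₂, x₂, hx₂1, h71⟩ := prop71_ii hφ hψ hε₀ hε₀1
  obtain ⟨B₀, hB₀0, hB₀⟩ := hφ.exists_bound
  obtain ⟨B₁, hB₁0, hB₁⟩ := hφ.exists_bound_deriv
  obtain ⟨Bψ, hBψ0, hBψ⟩ := hψ.exists_abs_le
  set η : ℝ := c₂ / 24 with hηdef
  have hη : 0 < η := by positivity
  obtain ⟨x₃, hx₃1, hx₃⟩ := exists_log_le_rpow hη
  set K₀ : ℝ := Bψ ^ 2 * (B₀ + 17 * B₁) * C₂ * ((H : ℝ) + 1) ^ 2 with hK₀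
  have hK₀0 : 0 ≤ K₀ := by positivity
  refine ⟨c₂ / 6, by positivity, 125 * (1 + Bψ) * K₀, by positivity,
    ⌈max (max x₂ x₃) (max 30 (((H : ℝ) + 1) ^ 4))⌉₊, ?_⟩
  intro x hx q _ χ hχ hq R hR1 hRx h h' hh hh' hne
  -- unpack the thresholds
  have hxr : max (max x₂ x₃) (max 30 (((H : ℝ) + 1) ^ 4)) ≤ (x : ℝ) :=
    le_trans (Nat.le_ceil _) (by exact_mod_cast hx)
  have hxx₂ : x₂ ≤ x := le_trans (le_trans (le_max_left _ _) (le_max_left _ _)) hxr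
  have hxx₃ : x₃ ≤ x := le_trans (le_trans (le_max_right _ _) (le_max_left _ _)) hxr
  have hx30 : (30 : ℝ) ≤ x := le_trans (le_trans (le_max_left _ _) (le_max_right _ _)) hxr
  have hxH4 : ((H : ℝ) + 1) ^ 4 ≤ x := le_trans (le_trans (le_max_right _ _) (le_max_right _ _)) hxr
  have hx1 : (1 : ℝ) ≤ x := by linarith only [hx30]
  have hx0 : (0 : ℝ) < x := by linarith only [hx30]
  have hmono : ∀ a b : ℝ, a ≤ b → (x : ℝ) ^ a ≤ (x : ℝ) ^ b :=
    fun a b hab => Real.rpow_le_rpow_of_exponent_le hx1 hab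
  have hxadd : ∀ a b : ℝ, (x : ℝ) ^ a * (x : ℝ) ^ b = (x : ℝ) ^ (a + b) :=
    fun a b => (Real.rpow_add hx0 a b).symm
  have hxge1 : ∀ a : ℝ, 0 ≤ a → 1 ≤ (x : ℝ) ^ a := fun a ha => Real.one_le_rpow hx1 ha
  have hlogx0 : 0 ≤ Real.log x := Real.log_nonneg hx1
  have hlogle : Real.log x ≤ (x : ℝ) ^ η := hx₃ x hxx₃
  -- `H ≤ x`, `(H+1)² ≤ x^{1/2}`
  have hH1 : (1 : ℝ) ≤ (H : ℝ) + 1 := by linarith only [(Nat.cast_nonneg H : (0 : ℝ) ≤ H)]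
  have hHx : H ≤ x := by
    have h1 : (H : ℝ) + 1 ≤ ((H : ℝ) + 1) ^ 4 := le_self_pow₀ hH1 (by norm_num)
    have : (H : ℝ) ≤ x := by linarith only [h1, hxH4, hH1]
    exact_mod_cast this
  have hHsq : ((H : ℝ) + 1) ^ 2 ≤ (x : ℝ) ^ (1 / 2 : ℝ) := by
    have h1 : (((H : ℝ) + 1) ^ 2) ^ 2 ≤ x := by rw [← pow_mul]; exact hxH4
    have h2 : ((H : ℝ) + 1) ^ 2 = ((((H : ℝ) + 1) ^ 2) ^ 2) ^ (1 / 2 : ℝ) := by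
      rw [← Real.sqrt_eq_rpow, Real.sqrt_sq (by positivity)]
    rw [h2]
    exact Real.rpow_le_rpow (by positivity) h1 (by norm_num)
  -- the per-`u` bound
  have hRc : R ≤ (x : ℝ) ^ (c₂ / 6) := hRx
  have H71 := h71 (x : ℝ) hxx₂ q χ hq R hR1 hRc
  set X : ℝ := Real.log x with hXdef
  set U₀ : ℝ := ε₀ / 20 * Real.log x + 2 * Real.log q with hU₀def
  have hS : ∀ u, |flatKernelSieveSum χ φ ψ X U₀ R x h h' u| ≤
      Bψ ^ 2 * (B₀ + 17 * B₁) * (C₂ * ((H : ℝ) + 1) ^ 2 * (x : ℝ) ^ (1 - c₂)) * R ^ 2 *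
        (1 + Real.log (12 * Real.sqrt x)) :=
    fun u => abs_flatKernelSieveSum_le χ hχ hφ hψ hB₀ hB₁ hBψ hR1 hh hh' hne hHx hx30 hHsq hC₂ H71 u
  -- the logarithmic factors
  have hlog12 : 1 + Real.log (12 * Real.sqrt x) ≤ 5 * (x : ℝ) ^ η := by
    rw [Real.log_mul (by norm_num) (Real.sqrt_pos.mpr hx0).ne', Real.log_sqrt hx0.le]
    have h12 : Real.log 12 ≤ 3 := by
      rw [Real.log_le_iff_le_exp (by norm_num)]
      have : (2.7 : ℝ) ≤ Real.exp 1 := by have := Real.exp_one_gt_d9; linarith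
      calc (12 : ℝ) ≤ 2.7 ^ 3 := by norm_num
        _ ≤ (Real.exp 1) ^ 3 := by gcongr
        _ = Real.exp 3 := by rw [← Real.exp_nat_mul]; norm_num
    have h1 := hxge1 η hη.le
    linarith only [h12, h1, hlogle]
  have hR2 : R ^ 2 ≤ (x : ℝ) ^ (c₂ / 3) := by
    have hR0 : 0 ≤ R := by linarith
    calc R ^ 2 ≤ ((x : ℝ) ^ (c₂ / 6)) ^ 2 := pow_le_pow_left₀ hR0 hRc 2
      _ = (x : ℝ) ^ (c₂ / 3) := by rw [← Real.rpow_natCast, ← Real.rpow_mul hx0.le]; ring_nf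
  set Sb : ℝ := Bψ ^ 2 * (B₀ + 17 * B₁) * (C₂ * ((H : ℝ) + 1) ^ 2 * (x : ℝ) ^ (1 - c₂)) * R ^ 2 *
    (1 + Real.log (12 * Real.sqrt x)) with hSbdef
  have hSb : Sb ≤ 5 * K₀ * (x : ℝ) ^ (1 - c₂ + c₂ / 3 + η) := by
    rw [hSbdef, show 1 - c₂ + c₂ / 3 + η = (1 - c₂) + (c₂ / 3) + η by ring, ← hxadd, ← hxadd, hK₀]
    have h0 : 0 ≤ Bψ ^ 2 * (B₀ + 17 * B₁) * (C₂ * ((H : ℝ) + 1) ^ 2 * (x : ℝ) ^ (1 - c₂)) := by positivity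
    calc Bψ ^ 2 * (B₀ + 17 * B₁) * (C₂ * ((H : ℝ) + 1) ^ 2 * (x : ℝ) ^ (1 - c₂)) * R ^ 2 *
          (1 + Real.log (12 * Real.sqrt x))
        ≤ Bψ ^ 2 * (B₀ + 17 * B₁) * (C₂ * ((H : ℝ) + 1) ^ 2 * (x : ℝ) ^ (1 - c₂)) * (x : ℝ) ^ (c₂ / 3) *
          (5 * (x : ℝ) ^ η) := by
          refine mul_le_mul (mul_le_mul_of_nonneg_left hR2 h0) hlog12 ?_ (by positivity)
          have : 0 ≤ Real.log (12 * Real.sqrt x) := Real.log_nonneg (by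
            have : 1 ≤ Real.sqrt x := by rw [← Real.sqrt_one]; exact Real.sqrt_le_sqrt hx1
            linarith only [this])
          linarith only [this]
      _ = _ := by ring
  have hexp : (x : ℝ) ^ (1 - c₂ + c₂ / 3 + η) * (x : ℝ) ^ (2 * η) ≤ (x : ℝ) ^ (1 - c₂ / 6) := by
    rw [hxadd]; exact hmono _ _ (by rw [hηdef]; linarith)
  have hU₀pos : 0 < U₀ := by
    rw [hU₀def]
    have hq1 : (1 : ℝ) ≤ q := by exact_mod_cast Nat.pos_of_ne_zero (NeZero.ne q)
    have : 0 ≤ Real.log q := Real.log_nonneg hq1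
    have : 0 < Real.log x := Real.log_pos (by linarith only [hx30])
    positivity
  have h2U₀ : 2 * U₀ ≤ X := by
    rw [hU₀def, hXdef]
    have hq0 : (0 : ℝ) < q := by exact_mod_cast Nat.pos_of_ne_zero (NeZero.ne q)
    have hlogq : Real.log q ≤ 1 / 20 * Real.log x := by
      calc Real.log q ≤ Real.log ((x : ℝ) ^ (1 / 20 : ℝ)) := Real.log_le_log hq0 hq
        _ = 1 / 20 * Real.log x := Real.log_rpow hx0 _
    have h1 : (ε₀ / 10 + 1 / 5) * Real.log x ≤ Real.log x := mul_le_of_le_one_left hlogx0 (by linarith only [hε₀1])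
    have h2 : 2 * (ε₀ / 20 * Real.log x + 2 * Real.log q) =
        (ε₀ / 10) * Real.log x + 4 * Real.log q := by ring
    have h3 : (ε₀ / 10 + 1 / 5) * Real.log x = (ε₀ / 10) * Real.log x + 4 * (1 / 20 * Real.log x) := by ring
    rw [h2]; rw [h3] at h1; linarith only [h1, hlogq]
  constructor
  · -- the `Λ_Siegel` slot
    have hb := abs_sum_flat_mul_siegel_le χ hφ ψ X U₀ R (x := x) (by exact_mod_cast (show 1 ≤ x by
      have : (1 : ℝ) ≤ x := hx1; exact_mod_cast this)) h h' hS
    refine hb.trans ?_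
    have hlog2 : (Real.log ((x + h' : ℕ) : ℝ) + 3) ^ 2 ≤ 25 * (x : ℝ) ^ (2 * η) := by
      have h1 : Real.log ((x + h' : ℕ) : ℝ) ≤ Real.log x + 1 := by
        have hxh : ((x + h' : ℕ) : ℝ) ≤ 2 * x := by
          have : ((x + h' : ℕ) : ℝ) ≤ x + H := by exact_mod_cast (show x + h' ≤ x + H by omega)
          have hHr : (H : ℝ) ≤ x := by exact_mod_cast hHx
          linarith only [this, hHr]
        calc Real.log ((x + h' : ℕ) : ℝ) ≤ Real.log (2 * x) :=
              Real.log_le_log (by exact_mod_cast (show 0 < x + h' by omega)) hxh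
          _ = Real.log 2 + Real.log x := Real.log_mul (by norm_num) hx0.ne'
          _ ≤ Real.log x + 1 := by have := Real.log_two_lt_d9; linarith only [this]
      have h2 : Real.log ((x + h' : ℕ) : ℝ) + 3 ≤ 5 * (x : ℝ) ^ η := by
        have := hxge1 η hη.le; linarith only [this, h1, hlogle]
      have h3 : 0 ≤ Real.log ((x + h' : ℕ) : ℝ) + 3 := by
        have : 0 ≤ Real.log ((x + h' : ℕ) : ℝ) := Real.log_nonneg (by exact_mod_cast (show 1 ≤ x + h' by omega))
        linarith only [this]
      calc (Real.log ((x + h' : ℕ) : ℝ) + 3) ^ 2 ≤ (5 * (x : ℝ) ^ η) ^ 2 := pow_le_pow_left₀ h3 h2 2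
        _ = 25 * (x : ℝ) ^ (2 * η) := by
            rw [mul_pow, ← Real.rpow_natCast ((x : ℝ) ^ η), ← Real.rpow_mul hx0.le]; norm_num; ring_nf
    have hSb0 : 0 ≤ Sb := (abs_nonneg _).trans (hS 0)
    calc (Real.log ((x + h' : ℕ) : ℝ) + 3) ^ 2 * Sb ≤ (25 * (x : ℝ) ^ (2 * η)) * (5 * K₀ * (x : ℝ) ^ (1 - c₂ + c₂ / 3 + η)) :=
          mul_le_mul hlog2 hSb hSb0 (by positivity)
      _ = 125 * K₀ * ((x : ℝ) ^ (1 - c₂ + c₂ / 3 + η) * (x : ℝ) ^ (2 * η)) := by ring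
      _ ≤ 125 * K₀ * (x : ℝ) ^ (1 - c₂ / 6) := mul_le_mul_of_nonneg_left hexp (by positivity)
      _ ≤ 125 * (1 + Bψ) * K₀ * (x : ℝ) ^ (1 - c₂ / 6) := by
          have : 125 * K₀ ≤ 125 * (1 + Bψ) * K₀ := by
            rw [mul_assoc]
            exact mul_le_mul_of_nonneg_left (le_mul_of_one_le_left hK₀0 (by linarith only [hBψ0])) (by norm_num)
          exact mul_le_mul_of_nonneg_right this (by positivity)
  · -- the `Λ♭_Siegel` slot
    have hb := abs_sum_flat_mul_flat_le χ hφ hψ hBψ hU₀pos h2U₀ R x h h' hS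
    refine hb.trans ?_
    have hX2 : X ^ 2 ≤ (x : ℝ) ^ (2 * η) := by
      calc X ^ 2 ≤ ((x : ℝ) ^ η) ^ 2 := pow_le_pow_left₀ hlogx0 hlogle 2
        _ = (x : ℝ) ^ (2 * η) := by rw [← Real.rpow_natCast, ← Real.rpow_mul hx0.le]; ring_nf
    have hSb0 : 0 ≤ Sb := (abs_nonneg _).trans (hS 0)
    have hBψ1 : 0 ≤ 1 + Bψ := by linarith only [hBψ0]
    calc 2 * ((1 + Bψ) * X ^ 2) * Sb ≤ 2 * ((1 + Bψ) * (x : ℝ) ^ (2 * η)) * (5 * K₀ * (x : ℝ) ^ (1 - c₂ + c₂ / 3 + η)) := by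
          refine mul_le_mul (by gcongr) hSb hSb0 (by positivity)
      _ = 10 * (1 + Bψ) * K₀ * ((x : ℝ) ^ (1 - c₂ + c₂ / 3 + η) * (x : ℝ) ^ (2 * η)) := by ring
      _ ≤ 10 * (1 + Bψ) * K₀ * (x : ℝ) ^ (1 - c₂ / 6) := mul_le_mul_of_nonneg_left hexp (by positivity)
      _ ≤ 125 * (1 + Bψ) * K₀ * (x : ℝ) ^ (1 - c₂ / 6) := by
          have : 10 * (1 + Bψ) * K₀ ≤ 125 * (1 + Bψ) * K₀ :=
            mul_le_mul_of_nonneg_right (mul_le_mul_of_nonneg_right (by norm_num) hBψ1) hK₀0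
          exact mul_le_mul_of_nonneg_right this (by positivity)


end TaoTeravainen

end Literature.Barriers.Parity
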